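import Summits.CriticalPhenomena.SAWScalingLimit.Theses.SAWMassiveIsingTilt
import Summits.CriticalPhenomena.SAWScalingLimit.Theorems.SAWMassiveIsingTiltDefs
import Summits.CriticalPhenomena.SAWScalingLimit.Theorems.SAWMassiveIsingTiltMassiveWindowSLEStubHullRestrictionOfDefect
import Summits.CriticalPhenomena.SAWScalingLimit.Theorems.SAWMassiveIsingTiltMassiveWindowSLEStubCommonEndpointApprox
import Summits.CriticalPhenomena.SAWScalingLimit.Theorems.SAWRenewalTightnessSubseqIdentificationRestrictionPassage
import Mathlib.MeasureTheory.Measure.Portmanteau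
import HarnessLib

/-!
# Crux `MassiveWindowSLE` (stmt-CriticalPhenomena-7685), line `registered` (skeleton r10):
stub `stub_avoidRestrictionOfDefect` — restriction defect + simple carriage ⇒ AVOIDANCE-form restriction

Route `SAWMassiveIsingTilt` of `CriticalPhenomena/SAWScalingLimit`; stub 2b' (passage glue) of the line
`registered` (`Cruxes/MassiveWindowSLE/Lines/birth.lean`, r10, lead c4). Objects: the window laws
`tiltLaw D.carrier δ (x δ) (1/√3 − m δ·δ) (a δ) (b δ)` (`Theorems/SAWMassiveIsingTiltDefs.lean`) pushed to
`CurveClass ℂ` by `γ ↦ γ.curve`, their weak limits `P D`, a hull subdomain `D'` of `D`, the removed hull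
`K = cl (D ∖ D')` (compact), the AVOIDANCE event `V = {γ | range γ ∩ K = ∅}` and its open exhaustion
`O_ε = {γ | ∀ z ∈ range γ, ∀ k ∈ K, ε < dist z k}` (`V = ⋃ₖ O_{1/(k+1)}` by compactness).

r10 replaces the closed conditioning event `N = {γ ⊆ cl D'}` of the landed stub 2b
(`stub_hullRestrictionOfDefect`, which needed the NoTouch input `P D (N ∖ V) = 0`, i.e. the unprinted
near-touch estimate 3a) by the avoidance event `V ⊆ N`: the SAME lattice defect gives
`P D' (T) · P D (V) = P D (T ∩ V)` with NO boundary estimate, because the `ε`-layer is now removed on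
the `P D`-side by monotone convergence `O_{1/(k+1)} ↑ V` instead of NoTouch. The avoidance form is all
the LSW identification consumes (`stub_hullRestrictionOfAvoidRestriction`).

* `ard_avoid_subset`, `ard_avoidLe_subset`, `ard_avoid_eq_iUnion`, `ard_measurableSet_avoid`,
  `ard_measure_avoid_eq_one` — bookkeeping of `V`, `O_ε`, `{ε ≤ dist}`; `P D' (V) = 1` by simple carriage
  in `D'` (`hrd_measure_touch_eq_zero`).
* `stub_avoidRestrictionOfDefect` — the registered signature. Proof: for closed `F`, layer `ε = 1/(k+1)`
  and defect `θ > 0`, `hrd_measure_inter_mul_le_of_tendstoLaw` (portmanteau along `δₙ → 0⁺`, landed with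
  2b) gives `P D (F ∩ O_ε) · P D' (O_ε) ≤ (1+θ)² P D {ε ≤ dist} P D' (F) ≤ (1+θ)² P D (V) P D' (F)`;
  `θ → 0⁺` (`hrd_le_of_forall_defect`), then `k → ∞` by continuity from below on both factors
  (`P D' (O_ε) ↑ P D' (V) = 1`); the equal-mass upgrade
  (`SubseqIdentification.BoundaryAreaLaw.ext_of_forall_isClosed_le`) turns `P D (F ∩ V) ≤ P D (V) P D' (F)`
  into the identity. Common endpoint approximations come from the landed stub C
  (`stub_commonEndpointApprox`). Fastness and the schedule are not used.

References: G. F. Lawler, O. Schramm, W. Werner, *Conformal restriction: the chordal case*, J. Amer.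
Math. Soc. 16 (2003), §3; P. Billingsley, *Convergence of probability measures*, 2nd ed. (1999),
Thm. 2.1 (portmanteau). No named fact is used; axioms `propext`, `Classical.choice`, `Quot.sound`.
-/

noncomputable section

namespace Summit.CriticalPhenomena.SAWScalingLimit.Theorems.MassiveWindowSLE.Birth

open scoped Topology NNReal ENNReal BoundedContinuousFunction
open Filter Set MeasureTheory Metric
open Literature.Probability Literature.Probability.LatticeModels
  Literature.Probability.RandomPlanarGeometry

/-- `O_ε ⊆ V` for `ε > 0`: a curve `ε`-away from `K` misses `K` (a common point is at distance `0`). -/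
theorem ard_avoid_subset (K : Set ℂ) {ε : ℝ} (hε : 0 < ε) :
    {γ : CurveClass ℂ | ∀ z ∈ γ.range, ∀ k ∈ K, ε < dist z k} ⊆ {γ | Disjoint γ.range K} := by
  intro γ hγ
  refine Set.disjoint_left.2 fun z hz hzK => ?_
  have h := hγ z hz z hzK
  rw [dist_self] at h
  exact lt_irrefl _ (hε.trans h)

/-- `{ε ≤ dist} ⊆ V` for `ε > 0`. -/
theorem ard_avoidLe_subset (K : Set ℂ) {ε : ℝ} (hε : 0 < ε) :
    {γ : CurveClass ℂ | ∀ z ∈ γ.range, ∀ k ∈ K, ε ≤ dist z k} ⊆ {γ | Disjoint γ.range K} := by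
  intro γ hγ
  refine Set.disjoint_left.2 fun z hz hzK => ?_
  have h := hγ z hz z hzK
  rw [dist_self] at h
  exact lt_irrefl _ (hε.trans_le h)

/-- **`V = ⋃ₖ O_{1/(k+1)}`**: a curve missing the compact `K` stays at positive distance from it
(`hrd_range_inter_nonempty`: approaching `K` at every scale means touching it). -/
theorem ard_avoid_eq_iUnion {K : Set ℂ} (hK : IsCompact K) :
    {γ : CurveClass ℂ | Disjoint γ.range K} =
      ⋃ k : ℕ, {γ : CurveClass ℂ | ∀ z ∈ γ.range, ∀ w ∈ K, 1 / ((k : ℝ) + 1) < dist z w} := by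
  ext γ
  simp only [mem_setOf_eq, mem_iUnion]
  constructor
  · intro hγ
    by_contra hno
    rw [not_exists] at hno
    have hne : (γ.range ∩ K).Nonempty := hrd_range_inter_nonempty hK γ fun k => by
      have hk := hno k
      simp only [not_forall, not_lt] at hk
      obtain ⟨z, hz, w, hw, hzw⟩ := hk
      exact ⟨z, hz, w, hw, hzw⟩
    obtain ⟨z, hz, hzK⟩ := hne
    exact Set.disjoint_left.1 hγ hz hzK
  · rintro ⟨k, hk⟩
    exact ard_avoid_subset K Nat.one_div_pos_of_nat hk

/-- `V` is Borel (a countable union of open events, `hrd_isOpen_avoid`). -/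
theorem ard_measurableSet_avoid {K : Set ℂ} (hK : IsCompact K) :
    MeasurableSet {γ : CurveClass ℂ | Disjoint γ.range K} := by
  rw [ard_avoid_eq_iUnion hK]
  exact MeasurableSet.iUnion fun k => (hrd_isOpen_avoid hK _).measurableSet

/-- **Simple carriage in `D'` gives `P D' (V) = 1`**: touching `cl (D ∖ D')` is `P D'`-null
(`hrd_measure_touch_eq_zero`), and `V` is the complement of the touching event. -/
theorem ard_measure_avoid_eq_one {P : ChordalFamily} (hP : P.IsChordal)
    (hS : P.IsCarriedBySimpleCurves) {D D' : DobrushinDomain} (hDD' : D.IsHullSubdomain D') :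
    P D' {γ : CurveClass ℂ | Disjoint γ.range (closure (D.carrier \ D'.carrier))} = 1 := by
  haveI : IsProbabilityMeasure (P D') := (hP D').1
  have hKc : IsCompact (closure (D.carrier \ D'.carrier)) :=
    isCompact_of_isClosed_isBounded isClosed_closure (D.isBounded.subset fun _ h => h.1).closure
  have hV : {γ : CurveClass ℂ | Disjoint γ.range (closure (D.carrier \ D'.carrier))} =
      {γ : CurveClass ℂ | (γ.range ∩ closure (D.carrier \ D'.carrier)).Nonempty}ᶜ := by
    ext γ
    simp only [mem_setOf_eq, mem_compl_iff, Set.not_nonempty_iff_eq_empty,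
      Set.disjoint_iff_inter_eq_empty]
  rw [hV, measure_compl, measure_univ, hrd_measure_touch_eq_zero hP hS hDD', tsub_zero]
  · rw [← compl_compl {γ : CurveClass ℂ | (γ.range ∩ closure (D.carrier \ D'.carrier)).Nonempty},
      ← hV]
    exact (ard_measurableSet_avoid hKc).compl
  · exact measure_ne_top _ _

/-- **Stub 2b' (passage glue, r10): restriction defect ⇒ avoidance-form restriction.** Given a window
limit family `P` (weak limit of the tilted interface laws in every Dobrushin domain along every
hexagonal endpoint approximation) which is chordal and carried by simple curves, and the two-sided
restriction defect with an `ε`-layer of the line's engine (R') for this schedule and tilt, `P` satisfies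
two-sided restriction over hull subdomains in AVOIDANCE form:
`P D' (T) · P D {γ ∩ cl (D ∖ D') = ∅} = P D (T ∩ {γ ∩ cl (D ∖ D') = ∅})`. Proof: common endpoint
approximations of the hull pair (`stub_commonEndpointApprox`, landed); for closed `F`, layer
`ε = 1/(k+1)` and defect `θ > 0`, portmanteau along a sequence of probability window laws
(`hrd_measure_inter_mul_le_of_tendstoLaw`) gives `P D (F ∩ O_ε) · P D' (O_ε) ≤ (1+θ)² P D (V) P D' (F)`
(`{ε ≤ dist} ⊆ V`); remove `θ` (`hrd_le_of_forall_defect`), let `k → ∞` by continuity from below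
(`O_{1/(k+1)} ↑ V`, `P D' (V) = 1` by `ard_measure_avoid_eq_one`), and upgrade the closed-set inequality
`P D (F ∩ V) ≤ P D (V) · P D' (F)` to the identity by equal total mass
(`SubseqIdentification.BoundaryAreaLaw.ext_of_forall_isClosed_le`). No NoTouch input is used. -/
theorem stub_avoidRestrictionOfDefect :
    ∀ (m x : ℝ → ℝ) (P : Literature.Probability.RandomPlanarGeometry.ChordalFamily), (∀ (D : Literature.Probability.RandomPlanarGeometry.DobrushinDomain) (a b : ℝ → Literature.Probability.LatticeModels.HexVertex), Literature.Probability.RandomPlanarGeometry.SAW.IsEmbEndpointApprox Literature.Probability.LatticeModels.hexGraph Literature.Probability.LatticeModels.hexCenter D a b → Literature.Probability.RandomPlanarGeometry.TendstoLaw (fun δ (γ : Literature.Probability.RandomPlanarGeometry.SAW.HexDomainSAW D.carrier δ (a δ) (b δ)) => γ.curve) (fun δ => Summit.CriticalPhenomena.SAWScalingLimit.Theorems.SAWMassiveIsingTilt.tiltLaw D.carrier δ (x δ) ((Real.sqrt 3)⁻¹ - m δ * δ) (a δ) (b δ)) id (P D)) → P.IsChordal → P.IsCarriedBySimpleCurves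 → (∀ (D D' : Literature.Probability.RandomPlanarGeometry.DobrushinDomain), D.IsHullSubdomain D' → ∀ (a b : ℝ → Literature.Probability.LatticeModels.HexVertex), Literature.Probability.RandomPlanarGeometry.SAW.IsEmbEndpointApprox Literature.Probability.LatticeModels.hexGraph Literature.Probability.LatticeModels.hexCenter D a b → Literature.Probability.RandomPlanarGeometry.SAW.IsEmbEndpointApprox Literature.Probability.LatticeModels.hexGraph Literature.Probability.LatticeModels.hexCenter D' a b → ∀ ε : ℝ, 0 < ε → ∀ θ : ℝ, 0 < θ → ∀ᶠ δ in nhdsWithin 0 (Set.Ioi 0), ∃ q : NNReal, ∀ B : Set (Literature.Probability.RandomPlanarGeometry.CurveClass ℂ), MeasurableSet B → (MeasureTheory.Measure.map (fun γ : Literature.Probability.RandomPlanarGeometry.SAW.HexDomainSAW D.carrier δ (a δ) (b δ) => γ.curve) (Summit.CriticalPhenomena.SAWScalingLimit.Theorems.SAWMassiveIsingTilt.tiltLaw D.carrier δ (x δ) ((Real.sqrt 3)⁻¹ - m δ * δ) (a δ) (b δ))) (B ∩ {γ : Literature.Probability.RandomPlanarGeometry.CurveClass ℂ | ∀ z ∈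 γ.range, ∀ k ∈ closure (D.carrier \ D'.carrier), ε < dist z k}) ≤ ENNReal.ofReal (1 + θ) * (q : ENNReal) * (MeasureTheory.Measure.map (fun γ : Literature.Probability.RandomPlanarGeometry.SAW.HexDomainSAW D'.carrier δ (a δ) (b δ) => γ.curve) (Summit.CriticalPhenomena.SAWScalingLimit.Theorems.SAWMassiveIsingTilt.tiltLaw D'.carrier δ (x δ) ((Real.sqrt 3)⁻¹ - m δ * δ) (a δ) (b δ))) (B ∩ {γ : Literature.Probability.RandomPlanarGeometry.CurveClass ℂ | ∀ z ∈ γ.range, ∀ k ∈ closure (D.carrier \ D'.carrier), ε < dist z k}) ∧ (q : ENNReal) * (MeasureTheory.Measure.map (fun γ : Literature.Probability.RandomPlanarGeometry.SAW.HexDomainSAW D'.carrier δ (a δ) (b δ) => γ.curve) (Summit.CriticalPhenomena.SAWScalingLimit.Theorems.SAWMassiveIsingTilt.tiltLaw D'.carrier δ (x δ) ((Real.sqrt 3)⁻¹ - m δ * δ) (a δ) (b δ))) (B ∩ {γ : Literature.Probability.RandomPlanarGeometry.CurveClass ℂ | ∀ z ∈ γ.range, ∀ k ∈ closure (D.carrier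 \ D'.carrier), ε < dist z k}) ≤ ENNReal.ofReal (1 + θ) * (MeasureTheory.Measure.map (fun γ : Literature.Probability.RandomPlanarGeometry.SAW.HexDomainSAW D.carrier δ (a δ) (b δ) => γ.curve) (Summit.CriticalPhenomena.SAWScalingLimit.Theorems.SAWMassiveIsingTilt.tiltLaw D.carrier δ (x δ) ((Real.sqrt 3)⁻¹ - m δ * δ) (a δ) (b δ))) (B ∩ {γ : Literature.Probability.RandomPlanarGeometry.CurveClass ℂ | ∀ z ∈ γ.range, ∀ k ∈ closure (D.carrier \ D'.carrier), ε < dist z k})) → ∀ (D D' : Literature.Probability.RandomPlanarGeometry.DobrushinDomain), D.IsHullSubdomain D' → ∀ T : Set (Literature.Probability.RandomPlanarGeometry.CurveClass ℂ), MeasurableSet T → P D' T * P D {γ | Disjoint γ.range (closure (D.carrier \ D'.carrier))} = P D (T ∩ {γ | Disjoint γ.range (closure (D.carrier \ D'.carrier))}) := by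
  intro m x P hconv hP hS hDef D D' hDD' T hT
  obtain ⟨a, b, hab, hab'⟩ := stub_commonEndpointApprox D D' hDD'
  haveI hμ : IsProbabilityMeasure (P D) := (hP D).1
  haveI hμ' : IsProbabilityMeasure (P D') := (hP D').1
  have hKc : IsCompact (closure (D.carrier \ D'.carrier)) :=
    isCompact_of_isClosed_isBounded isClosed_closure (D.isBounded.subset fun _ h => h.1).closure
  set V : Set (CurveClass ℂ) := {γ | Disjoint γ.range (closure (D.carrier \ D'.carrier))} with hVdef
  have hVm : MeasurableSet V := ard_measurableSet_avoid hKc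
  have hV1 : P D' V = 1 := ard_measure_avoid_eq_one hP hS hDD'
  -- the open exhaustion `O k = O_{1/(k+1)}` of `V`
  set O : ℕ → Set (CurveClass ℂ) := fun k => {γ : CurveClass ℂ | ∀ z ∈ γ.range,
    ∀ w ∈ closure (D.carrier \ D'.carrier), 1 / ((k : ℝ) + 1) < dist z w} with hOdef
  have hOmono : Monotone O := fun k l hkl γ hγ z hz w hw =>
    (Nat.one_div_le_one_div hkl).trans_lt (hγ z hz w hw)
  have hOV : (⋃ k, O k) = V := (ard_avoid_eq_iUnion hKc).symm
  -- the closed-set inequality `P D (F ∩ V) ≤ P D V · P D' F`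
  have hclosed : ∀ F : Set (CurveClass ℂ), IsClosed F → P D (F ∩ V) ≤ P D V * P D' F := by
    intro F hF
    -- one layer: the product inequality, defect removed
    have hcore : ∀ k : ℕ, P D (F ∩ O k) * P D' (O k) ≤ P D V * P D' F := by
      intro k
      refine hrd_le_of_forall_defect fun θ hθ => ?_
      have h := hrd_measure_inter_mul_le_of_tendstoLaw (μ := P D) (μ' := P D')
        (fun δ => SAW.EmbDomainSAW.measurable_of_top _)
        (fun δ => SAW.EmbDomainSAW.measurable_of_top _)
        (hrd_eventually_isProbabilityMeasure_tiltLaw (hconv D a b hab))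
        (hrd_eventually_isProbabilityMeasure_tiltLaw (hconv D' a b hab'))
        (hconv D a b hab) (hconv D' a b hab') (hrd_isOpen_avoid hKc (1 / ((k : ℝ) + 1)))
        (hrd_isClosed_avoidLe (closure (D.carrier \ D'.carrier)) (1 / ((k : ℝ) + 1)))
        (fun γ hγ z hz w hw => (hγ z hz w hw).le) (c := ENNReal.ofReal (1 + θ))
        ENNReal.ofReal_ne_top
        ((hDef D D' hDD' a b hab hab' (1 / ((k : ℝ) + 1)) Nat.one_div_pos_of_nat θ hθ).mono
          fun δ ⟨q, hq⟩ => ⟨(q : ℝ≥0∞), fun B hB => hq B hB⟩) hF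
      calc _ ≤ _ := h
        _ ≤ _ := by
          rw [mul_assoc]
          exact mul_le_mul_right (mul_le_mul_left (measure_mono
            (ard_avoidLe_subset _ Nat.one_div_pos_of_nat)) _) _
    -- `k → ∞`: continuity from below on both factors
    have h1 : Tendsto (fun k => P D (F ∩ O k)) atTop (𝓝 (P D (F ∩ V))) := by
      have hm : Monotone fun k => F ∩ O k := fun k l hkl => inter_subset_inter_right _ (hOmono hkl)
      have ht := tendsto_measure_iUnion_atTop (μ := P D) hm
      rwa [← inter_iUnion, hOV] at ht
    have h2 : Tendsto (fun k => P D' (O k)) atTop (𝓝 1) := by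
      have ht := tendsto_measure_iUnion_atTop (μ := P D') hOmono
      rwa [hOV, hV1] at ht
    have hprod : Tendsto (fun k => P D (F ∩ O k) * P D' (O k)) atTop (𝓝 (P D (F ∩ V) * 1)) :=
      ENNReal.Tendsto.mul h1 (Or.inr ENNReal.one_ne_top) h2 (Or.inr (measure_ne_top _ _))
    rw [mul_one] at hprod
    exact le_of_tendsto' hprod hcore
  -- equal mass: `P D (V) • P D' = P D |_V`
  haveI : IsFiniteMeasure (P D V • P D') := Measure.smul_finite _ (measure_ne_top _ _)
  have heq : P D V • P D' = (P D).restrict V :=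
    SubseqIdentification.BoundaryAreaLaw.ext_of_forall_isClosed_le
      (by rw [Measure.smul_apply, smul_eq_mul, measure_univ, mul_one, Measure.restrict_apply_univ])
      fun F hF => by
        rw [Measure.restrict_apply hF.measurableSet, Measure.smul_apply, smul_eq_mul]
        exact hclosed F hF
  have h' := congrArg (fun ρ : Measure (CurveClass ℂ) => ρ T) heq
  simp only [Measure.smul_apply, smul_eq_mul, Measure.restrict_apply hT] at h'
  rw [mul_comm, h']

end Summit.CriticalPhenomena.SAWScalingLimit.Theorems.MassiveWindowSLE.Birth

end
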